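import Literature.Geometry.Kaehler.ComplexTorusPolarizationFiniteProductInequality
import HarnessLib

/-!
# Debarre 1996, Théorème 3 along the addition map of finitely many abelian subvarieties
# (`h⁰(∏ Y_k, μ^*L) ≤ ∏ h⁰(Y_k, L|Y_k)`, equality iff the `Y_k` are pairwise orthogonal)

Layer `Literature/Geometry/Kaehler`, namespace `Literature.Geometry.Kaehler.ComplexTorus`; lane `lit-hodgefound`
(Track 2 foundations library), seat p16, generation 15, row g15-#1 FILE 2 (rider of
`ComplexTorusPolarizationFiniteProductInequality`). THEOREMS ONLY: no definition, no named fact, net debt `0`.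

## Source, VERBATIM

O. Debarre, *Polarisations sur les variétés abéliennes produits*, C. R. Acad. Sci. Paris Sér. I **323** (1996)
631–635 [Debarre1996PolarisationsProduits], § 2 p. 633 **Théorème 3** «Soit `L` un fibré en droites ample sur une
variété abélienne produit `X = ∏ᵢ₌₁ʳ Xᵢ`. On a `h⁰(X, L) ≤ ∏ᵢ₌₁ʳ h⁰(Xᵢ, L|Xᵢ)`. Pour qu'il y ait égalité, il faut et
il suffit que `L` soit isomorphe à `L|X₁ ⊠ ⋯ ⊠ L|X_r`.» and its use on p. 634 (proof of Corollaire 4): «de sorte que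
l'application `π : X₁ × X₂ → X` est une isogénie de degré `d`. Le théorème donne `h⁰(X₁ × X₂, π*L) ≤ h⁰(X₁, L|X₁)
h⁰(X₂, L|X₂)`.»

## What this rider adds

FILE 1 proves Théorème 3 (squared, `h⁰² = polarizationDegree`, and un-squared) for ANY Riemann form on the product
torus `sigmaPiPeriod Ψ`. Here it is applied, as in the printed deduction of Corollaire 4 but for `r` sub-varieties,
to the pull-back `μ^*η` of a polarisation `η` of ONE torus `X = E/ΦΛ` along the addition map
`μ = Σ_k ι_{V_k} : ∏_k Y_{V_k} → X` (p10's `sumRep` / `sumMatrix`, `ComplexTorusPoincareCompleteReducibilityIsogeny`)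
of a finite family of abelian subvarieties `Y_{V_k}` (complex lattice subspaces `V_k`) in direct sum (`iSupIndep V`,
i.e. `μ` has finite kernel): `μ^*η` is a Riemann form of `∏ Y_{V_k}` (`isRiemannForm_pullbackForm_sumRep_of_iSupIndep`),
its restriction to the factor `Y_{V_k}` is `η|Y_{V_k}` (`pullbackForm_single_pullbackForm_sumRep`), hence
**`debarre1996_theoreme_3_sum`**: `polarizationDegree (∏ Y_k, μ^*η) ≤ ∏_k polarizationDegree (Y_k, η|Y_k)`, with
equality iff the `V_k` are pairwise `η`-orthogonal (**`debarre1996_theoreme_3_sum_eq_iff`**; then `μ^*η = ⊞_k η|Y_k`,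
p10's `pullbackForm_sumRep` — the polarised isogeny of Poincaré's complete reducibility theorem), and VERBATIM for
`h⁰`: **`debarre1996_theoreme_3_sum_h0`** («`h⁰(∏ Y_k, μ*L) ≤ ∏ h⁰(Y_k, L|Y_k)`»). The binary case is
`debarre1996_theoreme_3` of `ComplexTorusPolarizationProductInequality` (carrier `prodPeriod`, not restated).
-- TODO(general form): the degree identity `h⁰(∏ Y_k, μ*L) = deg(μ) · h⁰(X, L)` for `⊕ V_k = Λ ⊗ ℝ` (Debarre prints it
-- for two sub-varieties only: `ComplexTorusPolarizationAdditionDegree`) is not restated for `r` sub-varieties.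

## References

* [Debarre1996PolarisationsProduits] O. Debarre, C. R. Acad. Sci. Paris Sér. I **323** (1996) 631–635, § 2 Théorème 3
  and the proof of Corollaire 4 (author's PDF `debarre-pub/33.pdf` pp. 3–4).
* [Lange2023AbelianVarietiesComplex] H. Lange, *Abelian Varieties over the Complex Numbers*, Springer 2023, §2.4.4
  Cor. 2.4.24 / Thm. 2.4.25 (the addition map, Poincaré's complete reducibility), §1.5.3 Thm. 1.5.9.
-/

noncomputable section

open Module Function Complex Matrix Finset

namespace Literature.Geometry.Kaehler

namespace ComplexTorus

section Sum

variable {ι : Type*} [Fintype ι] {E : Type*} [NormedAddCommGroup E] [NormedSpace ℂ E]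
  (Φ : (ι → ℝ) ≃L[ℝ] E) {κ : Type*} [Fintype κ] [DecidableEq κ] (V : κ → Submodule ℝ (ι → ℝ))

omit [Fintype ι] in
/-- **`μ ∘ ι_k = ι_{V_k}`**: the addition map restricted to the `k`-th factor of `∏_l Y_{V_l}` is the inclusion
`Y_{V_k} ⊆ X` — `μ(0, …, y, …, 0) = y`. [cite: Lange2023AbelianVarietiesComplex, §2.4.4 Cor. 2.4.24 (the addition map), p. 123] -/
theorem sumRep_single (k : κ) (y : cxSpan Φ (V k)) :
    sumRep Φ V (Pi.single k y) = (y : E) := by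
  rw [sumRep_apply, Finset.sum_eq_single k]
  · rw [Pi.single_eq_same]
  · intro l _ hlk
    rw [Pi.single_eq_of_ne hlk, ZeroMemClass.coe_zero]
  · exact fun h ↦ absurd (mem_univ k) h

omit [Fintype ι] in
/-- **`(μ^*η)|Y_{V_k} = η|Y_{V_k}`**: the restriction of `μ^*η` to the `k`-th factor of `∏_l Y_{V_l}` is the restriction
of `η` to the abelian subvariety `Y_{V_k}` («`L|Xᵢ`»). [cite: Debarre1996PolarisationsProduits, Théorème 3 and proof of Corollaire 4] -/
theorem pullbackForm_single_pullbackForm_sumRep (η : E [⋀^Fin 2]→L[ℝ] ℝ) (k : κ) :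
    pullbackForm (ContinuousLinearMap.single ℂ (fun l ↦ ↥(cxSpan Φ (V l))) k) (pullbackForm (sumRep Φ V) η) =
      pullbackForm (cxSpan Φ (V k)).subtypeL η := by
  ext x
  have hx : x = ![x 0, x 1] := by
    funext i
    fin_cases i <;> rfl
  rw [hx, pullbackForm_apply, pullbackForm_apply, pullbackForm_apply]
  change η ![sumRep Φ V (Pi.single k (x 0)), sumRep Φ V (Pi.single k (x 1))] = η ![((x 0 : cxSpan Φ (V k)) : E), (x 1 : E)]
  rw [sumRep_single, sumRep_single]

variable {Φ V} {η : E [⋀^Fin 2]→L[ℝ] ℝ}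

omit [DecidableEq κ] in
/-- **`μ^*η` is a polarisation of `∏_k Y_{V_k}` as soon as the `Y_{V_k}` are in direct sum** (`μ` has injective
analytic representation): «`π : X₁ × X₂ → X` est une isogénie … `π*L`» is ample — for `r` sub-varieties and without
the orthogonality hypothesis of p10's `isRiemannForm_pullbackForm_sumRep`.
[cite: Debarre1996PolarisationsProduits, proof of Corollaire 4] [cite: Lange2023AbelianVarietiesComplex, §2.1.1 Cor. 2.1.4 and §2.4.4 Cor. 2.4.24] -/
theorem isRiemannForm_pullbackForm_sumRep_of_iSupIndep (hη : IsRiemannForm Φ η) (hV : ∀ k, IsLatticeSubspace (V k))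
    (hVc : ∀ k, IsComplexSubspace Φ (V k)) (hind : iSupIndep V) :
    IsRiemannForm (sigmaPiPeriod fun k ↦ subtorusPeriod Φ (V k) (hV k) (hVc k)) (pullbackForm (sumRep Φ V) η) :=
  hη.pullback (sigmaPiPeriod fun k ↦ subtorusPeriod Φ (V k) (hV k) (hVc k)) Φ
    (fun x ↦ sumRep_sigmaPiPeriod Φ hV hVc x) (sumRep_injective Φ hVc hind)

/-- **Debarre 1996, Théorème 3 along the addition map of `r` abelian subvarieties, squared** («Le théorème donne
`h⁰(X₁ × X₂, π*L) ≤ h⁰(X₁, L|X₁) h⁰(X₂, L|X₂)`» for `r` sub-varieties): for a polarised torus `(X = E/ΦΛ, η)` and complex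
lattice subspaces `V_k` in direct sum (abelian subvarieties `Y_{V_k}` whose addition map `μ : ∏ Y_{V_k} → X` has finite
kernel), `polarizationDegree (∏ Y_{V_k}, μ^*η) ≤ ∏_k polarizationDegree (Y_{V_k}, η|Y_{V_k})`. The case `r = 2` is
`debarre1996_theoreme_3` (carrier `prodPeriod`). [cite: Debarre1996PolarisationsProduits, Théorème 3 and proof of Corollaire 4]
[cite: HornJohnson2013, §7.8 (7.8.7)] -/
theorem debarre1996_theoreme_3_sum (hη : IsRiemannForm Φ η) (hV : ∀ k, IsLatticeSubspace (V k))
    (hVc : ∀ k, IsComplexSubspace Φ (V k)) (hind : iSupIndep V) :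
    polarizationDegree (sigmaPiPeriod fun k ↦ subtorusPeriod Φ (V k) (hV k) (hVc k)) (pullbackForm (sumRep Φ V) η) ≤
      ∏ k, polarizationDegree (subtorusPeriod Φ (V k) (hV k) (hVc k)) (pullbackForm (cxSpan Φ (V k)).subtypeL η) := by
  have h := debarre1996_theoreme_3_pi (isRiemannForm_pullbackForm_sumRep_of_iSupIndep hη hV hVc hind)
  simpa only [pullbackForm_single_pullbackForm_sumRep] using h

/-- **The equality case: iff the `Y_{V_k}` are pairwise `η`-orthogonal** (`η(ΦV_k, ΦV_l) = 0` for `k ≠ l`; then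
`μ^*η = ⊞_k η|Y_{V_k}`, p10's `pullbackForm_sumRep` — `μ` is an isogeny of POLARISED tori, as in Poincaré's complete
reducibility theorem). [cite: Debarre1996PolarisationsProduits, Théorème 3] [cite: Lange2023AbelianVarietiesComplex, §2.4.4 Cor. 2.4.24 and Thm. 2.4.25] -/
theorem debarre1996_theoreme_3_sum_eq_iff (hη : IsRiemannForm Φ η) (hV : ∀ k, IsLatticeSubspace (V k))
    (hVc : ∀ k, IsComplexSubspace Φ (V k)) (hind : iSupIndep V) :
    polarizationDegree (sigmaPiPeriod fun k ↦ subtorusPeriod Φ (V k) (hV k) (hVc k)) (pullbackForm (sumRep Φ V) η) =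
        ∏ k, polarizationDegree (subtorusPeriod Φ (V k) (hV k) (hVc k)) (pullbackForm (cxSpan Φ (V k)).subtypeL η) ↔
      ∀ k l, k ≠ l → ∀ v ∈ V k, ∀ w ∈ V l, η ![Φ v, Φ w] = 0 := by
  have h := debarre1996_theoreme_3_pi_eq_iff (isRiemannForm_pullbackForm_sumRep_of_iSupIndep hη hV hVc hind)
  simp only [pullbackForm_single_pullbackForm_sumRep] at h
  rw [h]
  constructor
  · intro h0 k l hkl v hv w hw
    have hv' : Φ v ∈ cxSpan Φ (V k) := (mem_cxSpan_iff (hVc k)).2 (by rwa [ContinuousLinearEquiv.symm_apply_apply])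
    have hw' : Φ w ∈ cxSpan Φ (V l) := (mem_cxSpan_iff (hVc l)).2 (by rwa [ContinuousLinearEquiv.symm_apply_apply])
    have h1 := h0 k l hkl ⟨Φ v, hv'⟩ ⟨Φ w, hw'⟩
    rwa [pullbackForm_apply, sumRep_single, sumRep_single] at h1
  · intro h0 k l hkl u v
    rw [pullbackForm_apply, sumRep_single, sumRep_single]
    have h1 := h0 k l hkl _ ((mem_cxSpan_iff (hVc k)).1 u.2) _ ((mem_cxSpan_iff (hVc l)).1 v.2)
    rwa [ContinuousLinearEquiv.apply_symm_apply, ContinuousLinearEquiv.apply_symm_apply] at h1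

/-- **Strict inequality** when two of the subvarieties are not `η`-orthogonal. [cite: Debarre1996PolarisationsProduits, Théorème 3] -/
theorem debarre1996_theoreme_3_sum_lt (hη : IsRiemannForm Φ η) (hV : ∀ k, IsLatticeSubspace (V k))
    (hVc : ∀ k, IsComplexSubspace Φ (V k)) (hind : iSupIndep V)
    (h : ¬ ∀ k l, k ≠ l → ∀ v ∈ V k, ∀ w ∈ V l, η ![Φ v, Φ w] = 0) :
    polarizationDegree (sigmaPiPeriod fun k ↦ subtorusPeriod Φ (V k) (hV k) (hVc k)) (pullbackForm (sumRep Φ V) η) <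
      ∏ k, polarizationDegree (subtorusPeriod Φ (V k) (hV k) (hVc k)) (pullbackForm (cxSpan Φ (V k)).subtypeL η) :=
  lt_of_le_of_ne (debarre1996_theoreme_3_sum hη hV hVc hind)
    fun heq ↦ h ((debarre1996_theoreme_3_sum_eq_iff hη hV hVc hind).1 heq)

/-- **The equality case with the product form**: equality iff `μ^*η = ⊞_k η|Y_{V_k}` (p10's `piForm`).
[cite: Debarre1996PolarisationsProduits, Théorème 3] -/
theorem debarre1996_theoreme_3_sum_eq_iff_piForm (hη : IsRiemannForm Φ η) (hV : ∀ k, IsLatticeSubspace (V k))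
    (hVc : ∀ k, IsComplexSubspace Φ (V k)) (hind : iSupIndep V) :
    polarizationDegree (sigmaPiPeriod fun k ↦ subtorusPeriod Φ (V k) (hV k) (hVc k)) (pullbackForm (sumRep Φ V) η) =
        ∏ k, polarizationDegree (subtorusPeriod Φ (V k) (hV k) (hVc k)) (pullbackForm (cxSpan Φ (V k)).subtypeL η) ↔
      pullbackForm (sumRep Φ V) η = piForm fun k ↦ pullbackForm (cxSpan Φ (V k)).subtypeL η := by
  have h := debarre1996_theoreme_3_pi_eq_iff_piForm (isRiemannForm_pullbackForm_sumRep_of_iSupIndep hη hV hVc hind)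
  simp only [pullbackForm_single_pullbackForm_sumRep] at h
  exact h

/-- **The orthogonal (Poincaré) case**: for pairwise `η`-orthogonal `Y_{V_k}` in direct sum,
`polarizationDegree (∏ Y_{V_k}, μ^*η) = ∏_k polarizationDegree (Y_{V_k}, η|Y_{V_k})` («`h⁰(X, N) = h⁰(X₁, L₁) h⁰(X₂, L₂)`»
in the proof of Théorème 1). [cite: Debarre1996PolarisationsProduits, Théorème 3 and proof of Théorème 1]
[cite: Lange2023AbelianVarietiesComplex, §2.4.4 Thm. 2.4.25] -/
theorem polarizationDegree_pullbackForm_sumRep_of_orthogonal (hη : IsRiemannForm Φ η)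
    (hV : ∀ k, IsLatticeSubspace (V k)) (hVc : ∀ k, IsComplexSubspace Φ (V k)) (hind : iSupIndep V)
    (ho : ∀ k l, k ≠ l → ∀ v ∈ V k, ∀ w ∈ V l, η ![Φ v, Φ w] = 0) :
    polarizationDegree (sigmaPiPeriod fun k ↦ subtorusPeriod Φ (V k) (hV k) (hVc k)) (pullbackForm (sumRep Φ V) η) =
      ∏ k, polarizationDegree (subtorusPeriod Φ (V k) (hV k) (hVc k)) (pullbackForm (cxSpan Φ (V k)).subtypeL η) :=
  (debarre1996_theoreme_3_sum_eq_iff hη hV hVc hind).2 ho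

end Sum

/-! ### The same for `h⁰` -/

section H0

variable {ι : Type*} [Fintype ι] {E : Type*} [NormedAddCommGroup E] [NormedSpace ℂ E]
  {Φ : (ι → ℝ) ≃L[ℝ] E} {κ : Type*} [Fintype κ] [DecidableEq κ] {V : κ → Submodule ℝ (ι → ℝ)}
  {η : E [⋀^Fin 2]→L[ℝ] ℝ}

omit [Fintype ι] [Fintype κ] [DecidableEq κ] in
/-- `a² ≤ b²` in `ℝ` for naturals gives `a ≤ b`. [folklore] -/
private theorem natCast_le_of_sq_le₄ {a b : ℕ} (h : (a : ℝ) ^ 2 ≤ (b : ℝ) ^ 2) : a ≤ b := by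
  have := (pow_le_pow_iff_left₀ (Nat.cast_nonneg a) (Nat.cast_nonneg b) two_ne_zero).1 h
  exact_mod_cast this

omit [Fintype ι] [Fintype κ] [DecidableEq κ] in
/-- `a² = b²` in `ℝ` for naturals iff `a = b`. [folklore] -/
private theorem natCast_sq_eq_sq_iff₄ {a b : ℕ} : (a : ℝ) ^ 2 = (b : ℝ) ^ 2 ↔ a = b := by
  rw [pow_left_inj₀ (Nat.cast_nonneg a) (Nat.cast_nonneg b) two_ne_zero, Nat.cast_inj]

/-- **«Le théorème donne `h⁰(∏ Y_k, μ*L) ≤ ∏ h⁰(Y_k, L|Y_k)`», VERBATIM for `h⁰` and `r` abelian subvarieties in direct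
sum**: for `L = L(H, χ)` on `X`, `μ*L = L(μ*H, χ')` on `∏ Y_{V_k}` and `L|Y_{V_k} = L(H|Y_{V_k}, χ_k)` (any semicharacters
— `h⁰` depends on the type only). [cite: Debarre1996PolarisationsProduits, Théorème 3 and proof of Corollaire 4]
[cite: Lange2023AbelianVarietiesComplex, §1.5.3 Thm. 1.5.9] -/
theorem debarre1996_theoreme_3_sum_h0 (hη : IsRiemannForm Φ η) (hV : ∀ k, IsLatticeSubspace (V k))
    (hVc : ∀ k, IsComplexSubspace Φ (V k)) (hind : iSupIndep V)
    {χ : ((Σ k, Fin (subRank (V k))) → ℤ) → ℂ}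
    (hχ : IsSemicharacter (sigmaPiPeriod fun k ↦ subtorusPeriod Φ (V k) (hV k) (hVc k)) (pullbackForm (sumRep Φ V) η) χ)
    {χk : ∀ k, (Fin (subRank (V k)) → ℤ) → ℂ}
    (hχk : ∀ k, IsSemicharacter (subtorusPeriod Φ (V k) (hV k) (hVc k)) (pullbackForm (cxSpan Φ (V k)).subtypeL η) (χk k)) :
    (lineBundleAH (isRiemannForm_pullbackForm_sumRep_of_iSupIndep hη hV hVc hind).isNSForm hχ).h0 ≤
      ∏ k, (lineBundleAH (isRiemannForm_restrict Φ hη (hV k) (hVc k)).isNSForm (hχk k)).h0 := by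
  apply natCast_le_of_sq_le₄
  push_cast
  rw [← prod_pow, (isRiemannForm_pullbackForm_sumRep_of_iSupIndep hη hV hVc hind).sq_h0_lineBundleAH_eq_polarizationDegree hχ,
    prod_congr rfl fun k _ ↦ (isRiemannForm_restrict Φ hη (hV k) (hVc k)).sq_h0_lineBundleAH_eq_polarizationDegree (hχk k)]
  exact debarre1996_theoreme_3_sum hη hV hVc hind

/-- **The equality case for `h⁰`**: `h⁰(∏ Y_k, μ*L) = ∏ h⁰(Y_k, L|Y_k)` iff the `Y_{V_k}` are pairwise `Im H`-orthogonal.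
[cite: Debarre1996PolarisationsProduits, Théorème 3] -/
theorem debarre1996_theoreme_3_sum_h0_eq_iff (hη : IsRiemannForm Φ η) (hV : ∀ k, IsLatticeSubspace (V k))
    (hVc : ∀ k, IsComplexSubspace Φ (V k)) (hind : iSupIndep V)
    {χ : ((Σ k, Fin (subRank (V k))) → ℤ) → ℂ}
    (hχ : IsSemicharacter (sigmaPiPeriod fun k ↦ subtorusPeriod Φ (V k) (hV k) (hVc k)) (pullbackForm (sumRep Φ V) η) χ)
    {χk : ∀ k, (Fin (subRank (V k)) → ℤ) → ℂ}
    (hχk : ∀ k, IsSemicharacter (subtorusPeriod Φ (V k) (hV k) (hVc k)) (pullbackForm (cxSpan Φ (V k)).subtypeL η) (χk k)) :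
    (lineBundleAH (isRiemannForm_pullbackForm_sumRep_of_iSupIndep hη hV hVc hind).isNSForm hχ).h0 =
        ∏ k, (lineBundleAH (isRiemannForm_restrict Φ hη (hV k) (hVc k)).isNSForm (hχk k)).h0 ↔
      ∀ k l, k ≠ l → ∀ v ∈ V k, ∀ w ∈ V l, η ![Φ v, Φ w] = 0 := by
  rw [← debarre1996_theoreme_3_sum_eq_iff hη hV hVc hind, ← natCast_sq_eq_sq_iff₄]
  push_cast
  rw [← prod_pow, (isRiemannForm_pullbackForm_sumRep_of_iSupIndep hη hV hVc hind).sq_h0_lineBundleAH_eq_polarizationDegree hχ,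
    prod_congr rfl fun k _ ↦ (isRiemannForm_restrict Φ hη (hV k) (hVc k)).sq_h0_lineBundleAH_eq_polarizationDegree (hχk k)]

end H0

end ComplexTorus

end Literature.Geometry.Kaehler

end
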